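import Literature.MathematicalPhysics.QuantumFieldTheory.Balaban1983to89.T4FlagMemory
import Literature.MathematicalPhysics.QuantumFieldTheory.Balaban1983to89.T4OutputRate

/-!
# T4BetaReadOut — the U3 → U2 LIAISON: node U2's NE4 hypothesis shapes for the β-functions (`ScaleShiftRate`,
`HistLipschitz`, `FadingMemory` of `T4CouplingMatching`) FROM node U3's typed shapes for the output terms (`NE5`, `NE9`,
`FadingMemory` of `T4OutputRate`) composed with the printed READ-OUT of β_{j+1} from E^{(j+1)} ([Balaban1987RG1]
(1.20)–(1.22) p. 264), BY NAME; and the converse: on the one-point β-carrier U2's shapes ARE U3's shapes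
(cell `pub-balaban`, T4-DAG v17 §2 nodes U2/U3, §6 NE4/NE5/NE9; journal row T4-U2.NE4-PROVE-P1c*; typing + bookkeeping only)

HONEST FRAMING (T4-DAG PAGE 1).  The cell's T4 target is rung (B)+1: existence AND uniqueness of the ε → 0 limit of
Bałaban's unit-scale averaged expectations on a FIXED finite torus — strictly beyond ultraviolet stability
([Balaban1988Convergent] Cor. 3 p. 264; [Balaban1989LargeFieldII] Thm 1 p. 355), and NOT infinite volume, NOT a mass gap,
NOT the Clay problem.  This module ASSERTS NOTHING about Bałaban's functionals: every `def … : Prop` is a HYPOTHESIS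
SHAPE over the ABSTRACT carriers of `T4OutputRate` (binders, consumed by the spine, never used as facts), and every
`theorem` is kernel-checked real-number bookkeeping.  Value = a DAG edge made kernel (node U2's NEW-ESTIMATE shapes are
CONSEQUENCES of node U3's + one printed-structure read-out), NOT summit progress.

WHAT IS PRINTED (quotations as certified in the headers of the tree modules `T4CouplingMatching` v1.2 — renders
`…1987-cmp109-rg-I-small-field-p015/p016-x2.png` read as images by unit `b2b-balaban-pv16` gen 4, GAPS C-pv10-23 — and
`T4OutputRate` v1.1 — `t4/T4-XREAD-U3.md` §1, GAPS C-pv05g4-5; this lineage's gen 1 re-read p. 264 / p. 268 first-hand,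
record `t4/T4-EST-NE4-P1.md` §1 (S3)/(S4); journal page = PDF page + 248 for CMP **109**):
* [Balaban1987RG1] p. 264: *"the β-functions β_{j+1}(g_j). They are determined by the functions E^{(j+1)}(g_j, U_{j+1}) in
  (1.6). Let us denote E^{(j+1)}(g_j, B) = E^{(j+1)}(g_j, U_{j+1}(exp iB)). We define Π^{ab}_{j+1,μν}(g_j, x, x′) =
  (δ²/δB^a_μ(x)δB^b_ν(x′) E^{(j+1)})(g_j, 0). (1.20)"* — *"By the Euclidean invariance of E^{(j+1)} the function (1.20) is
  Euclidean covariant. This implies Π^{ab}_{j+1,μν}(g_j, x, x′) = δ^{ab}Π_{j+1,μν}(g_j, x − x′), […] (1.21) […] Now we take a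
  limit of these functions as T^{(j+1)} ↗ Z^d. This limit exists by the localized representation (1.7)."* — *"β_{j+1}(g_j) =
  […] = Σ_x Π_{j+1,μν}(g_j, x)x_μx_ν (1.22) for μ, ν arbitrary, μ ≠ ν"*; and *"It is a smooth function defined on the interval
  [0, γ], (or analytic), uniformly bounded on this interval together with all derivatives."*; Theorem 3 p. 264 is stated
  for *"0 < g_k ≤ γ"* and *"The constant γ depends on all other constants."*
* [Balaban1987RG1] p. 298: *"We write β_j as explicitly dependent on g_{j−1}, although it depends also on all preceding
  coupling constants."*; p. 256: *"The function E_k depends also on the effective coupling constants g₀, …, g_{k−1}."*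
* [Balaban1987RG1] p. 263: *"We assume that the function E^{(j)}(X, g_{j−1}, U, J) is defined and analytic on the space
  U^c_j(X, α₀, α₁), with some positive, absolute constants α₀, α₁ (i.e., constants independent of X and j). It depends on
  the configurations restricted to X, i.e. on (U, J)|_X."* and (1.18) *"|E^{(j)}(X, g_{j−1}, U, J)| ≤ E₀ exp(−κd_j(X))"*;
  p. 259: *"the above bound is uniform in the lattice spacing ε."*
* [Balaban1988Convergent] p. 259 (2.28): *"α_{0,j} = g_jC₀(log g_j^{−2})^{q₀}, α_{1,j} = g_jC₁(log g_j^{−2})^{q₁}"* (in the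
  spaces of [III] the analyticity radii SHRINK with g_j — cell GAPS G-t4-U3-2).
READING [analysis, this seat]: (1.20)–(1.22) make β_{j+1} a LINEAR functional ("the recipe" r) of the scale-(j+1) output
E^{(j+1)} as a function of the background — second functional derivative at B = 0 along the probe configurations
`U_{j+1}(exp iB)`, translation reduction, infinite-volume limit, second moment — the SAME recipe at every step j.
NOT PRINTED anywhere in [Balaban1987RG1], [Balaban1988RG2Cluster], [Balaban1988Convergent] (cell GAPS G-t4-U2-1, G-t4-U2-2,
G-t4-U3-1, G-t4-U3-3; `t4/T4-XREAD-U2.md` §3, `t4/T4-XREAD-U3.md`): any dependence of β_{j} or of E^{(j)} on the scale j at fixed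
recent history (the η-rate: cell NE4 / NE5), any modulus of the dependence on the preceding couplings (cell NE9), and
the NORM CONSTANT of the recipe r relative to the weighted sup-bound (1.18) — what a Cauchy estimate in B on
U^c(X, α₀, α₁) plus the locality sums Σ_{X ∋ x} |X|·diam(X)²·e^{−κd_j(X)} would give; of printed TYPE (every ingredient
has its printed counterpart on p. 263/p. 264), NOT PRINTED as a statement or a number (cell convention (C5) of
`t4/T4-EST-U2R.md`; GAPS C-ne4p1-7).  It would be UNIFORM in the couplings only with the ABSOLUTE α₀, α₁ of [I] p. 263;
with the radii (2.28) of [III] it degrades like α_{1,j}^{−2} (G-t4-U3-2).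

## What is typed and proved

§1 THE READ-OUT (R), four binders over `T4OutputRate.Carriers C` / `Functional C Bg` (node U3's carriers AFTER the
   run-A/run-B pairing; `Slice C Bg := Bg → C.Dom → ℝ` = a term family at fixed couplings, `ReadOut C Bg := ℕ → Slice C Bg
   → ℝ` = one recipe per step): `RepresentsA E r γ β` — node U2's history β-function `β k v` (= β_{k+1}(v₀, …, v_k),
   `FlowStep.HBeta`) IS the recipe `r k` applied to run A's terms at the couplings `extd v` (read on the scale-(k+1) slice)
   [STRUCTURE PRINTED: (1.20)–(1.22)]; `RepresentsB EB rB γ β` — the same β-family read off run B's RE-INDEXED terms one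
   step later, with run B's UNPAIRED first coupling `w 0 = g^B_0` as an explicit PARAMETER `EB : ℝ → Functional C C.BgB`
   (node U3's re-indexing convention, GAPS G-t4-U3-5, types `EB` for ONE value of that datum; the β-functions are
   evaluated at EVERY admissible value of it, so the datum must be a parameter and NE5 uniform in it — located precision
   GAPS C-ne4p1-8); `ReadBounded r κ cr` — the recipe is `cr`-dominated by the weighted sup-closeness of two term families
   on the slice (`SliceClose`; PRINTED-INGREDIENT SHAPE exactly like `T4OutputRate.LipBackground`: linear recipe + Cauchy
   in B + locality sums, the Cauchy step NOT carried out here, `cr` NOT PRINTED); `ReadCovariant rA rB κ cr` — run A's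
   recipe of a family seen THROUGH `C.transport` and run B's recipe of a family transport-close to it give `cr`-close
   numbers (the two runs use the same recipe (1.20)–(1.22) on their unit lattices and the transport maps run B's probe
   configurations to run A's: a PAIRING CONVENTION of the status of `Carriers.transport` itself — UNPRINTED, GAPS
   G-t4-U1a-2 / G-t4-U3-5).  WHICH CARRIER [analysis]: the recipe needs the terms at the COMPLEX probe backgrounds
   `U_{j+1}(exp iB)`, B near 0, and AFTER the limit T^{(j+1)} ↗ Z^d (p. 264) — so the read-out consumes node U3's shapes on
   the INFINITE-VOLUME carrier with probe backgrounds, a SECOND INSTANCE of pv05's carrier-polymorphic shapes, not the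
   instance on the torus at the backgrounds driven by the unit-lattice field that `T4OutputRate.u3_geometric` consumes
   (GAPS C-ne4p1-9).  Nothing here fixes the carrier: `C`, `Bg` are whatever the instancer supplies.
§2 THE LIAISON (kernel, [folklore]-level bookkeeping): `scaleShiftRate_of_ne5` — NE5 for every datum b ∈ ]0, γ] + (R) ⇒
   `T4CouplingMatching.ScaleShiftRate (cr·C₅·θ) θ γ β` (one line: β_{k+2}(w) − β_{k+1}(tail w) = rB(EB) − rA(EA) at the
   SAME re-indexed couplings, transport-close by NE5 at scale k + 1); `histLipschitz_of_ne9` — NE9 + (R) ⇒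
   `HistLipschitz (fun k i ↦ cr·Λ (k+1) i) γ β`; `fadingMemory_readOut` — `T4OutputRate.FadingMemory C₉ ω Λ` ⇒
   `T4CouplingMatching.FadingMemory (cr·C₉·ω) ω (fun k i ↦ cr·Λ (k+1) i)` (index shift k ↦ k + 1 costs one factor ω);
   `scaleShiftRate_mono`; `ne4_of_u3` (node U2's TRIPLE with the η-rate θ and the memory rate ω) and `ne4_of_u3_oneRate`
   (both at any common rate ρ ≥ max θ ω); `injectedRate_of_u3` = `ne4_of_u3_oneRate` ∘ pv16's
   `T4CouplingMatching.injectedRate_of_runs_eventual` ⇒ `T4CauchySum.InjectedRate (2·cr·C₅·θ/(1−ρ)) 0 ρ (disc …)` — verbatim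
   the binder `hinj` of `T4TowerRateDischarge.uRateUpTo_of_nodes` / `uRateUpTo_of_margin` (node U5, t4-ne7-p1 lineage;
   named, not imported) with `Cd = 2·cr·C₅·θ/(1−ρ)`, `θc = ρ`; the cell's SPLIT booking (T4-DAG §6: β⁰-half = (AF-0r) of the
   β sub-cell, β¹-half = `RemainderShiftRate`): `remainderShiftRate_of_ne5` (the same read-out for the remainder β¹ of a
   `B12Beta.OneLoopSplit` off a remainder term family) and `scaleShiftRate_of_ne5_split` (∘ pv16 `scaleShiftRate_of_split`).
§3 THE CONVERSE ON THE β-CARRIER (kernel): `betaCarriers` (domains ℕ with `scale n = n + 1`, zero tree length, one-point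
   backgrounds, identity transport), `betaEA β` / `betaEB β b` (the β-family itself as run A's functional and, with the
   datum b consed in front, as run B's re-indexed functional), `betaRead` (evaluation); `representsA_beta`,
   `representsB_beta`, `readBounded_beta` (cr = 1), `readCovariant_beta`; `ne9_beta_of_histLipschitz`,
   `fadingMemory_beta`, `ne5_beta_of_scaleShiftRate` (C₅ = c/θ): node U2's three shapes for β ARE node U3's three shapes
   on this carrier, and §2 takes them back with the same constants (`scaleShiftRate_roundTrip`, `histLipschitz_roundTrip`,
   `fadingMemory_roundTrip`, `roundTrip_const`, `histLipschitz_shiftModuli_iff`), packaged as the IFF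
   `u2Shapes_iff_u3Shapes_on_betaCarrier` — so, AS TYPED IN THE TREE, NE4's hypothesis shapes are an INSTANCE of
   NE5 ∧ NE9 ∧ FadingMemory, and node U2 carries NO
   estimate KIND of its own: its located residue is the read-out constant `cr` (convention), the closure window
   (γ-smallness, pv16 / t4-ne4-p2) and the asymptotic-freedom inputs of the β sub-cell (`EventualLowerH` / (AF-0r), H3).
RELATION TO THIS LINEAGE'S EARLIER LEAVES (by name): `T4FlagMemory` / `T4FlagMemoryTwoRun` DERIVE node U2's shapes from
ONE-STEP hypotheses (M)(S)(D)(R) of an iterated map on a growing flag (the MECHANISM by which cumulative shapes of the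
NE5/NE9 kind arise, with the kernel-sharp window (1 + C′)ω < ρ of `T4BetaMemorySharp`); the present leaf CONSUMES node
U3's cumulative shapes as pv05 typed them and needs no scheme.  The two meet in the booking: NE5/NE9 on the read-out
carrier are what a flag scheme valued in term slices would produce (`T4FlagMemory.dist_entry_le`, `scaleShiftRate_of_scheme`).

Deliberately NOT here: any instance of NE5/NE9 or of the read-out constant for Bałaban's (2.13) (cell NEW ESTIMATES,
not in print); the infinite-volume limit (1.21)–(1.22) itself (tree `B12Beta.Kernel`/`secondMoment` type the recipe's
last two steps; the limit is a printed EXISTENCE statement, p. 264, not used); the two-run closure of t4-ne4-p2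
(`T4TwoRunMatching` consumes scheme-level located estimates, not box shapes — see the U3 owner's NOTE, journal l.48409,
on which closure accepts which currency).

CITATION HEADER (lean-in-tree rule 2026-08-18).  Sources quoted: T. Bałaban, *Renormalization group approach to lattice
gauge field theories. I. Generation of effective actions in a small field approximation and a coupling constant
renormalization in four dimensions*, Commun. Math. Phys. **109**, 249–301 (1987) [Balaban1987RG1] (cell paper B12 = [I];
held `paper:balaban1987-cmp109-rg-i-small-field`); T. Bałaban, *Convergent renormalization expansions for lattice gauge
theories*, Commun. Math. Phys. **119**, 243–285 (1988) [Balaban1988Convergent] (B14 = [III]); T. Bałaban, *Large field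
renormalization. II*, Commun. Math. Phys. **122**, 355–392 (1989) [Balaban1989LargeFieldII] (B16; Thm 1 p. 355 named for the
framing only).  The Bałaban papers are manuscripts UNDER ADJUDICATION by the audit cell `pub-balaban`: NOTHING printed in
them is asserted here.  NEW module of unit `b2b-balaban-t4-ne4-p1-g3` (NE4 prover P1, gen 3; journal ONLINE + CLAIM
T4-U2.NE4-PROVE-P1c* l.48536); imports the tree modules `T4FlagMemory` (this lineage) and `T4OutputRate` (pv05, BY NAME)
and modifies nothing.
-/

namespace Literature.MathematicalPhysics.QuantumFieldTheory.Balaban1983to89.T4BetaReadOut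

open Literature.MathematicalPhysics.QuantumFieldTheory.Balaban1983to89
open Literature.MathematicalPhysics.QuantumFieldTheory.Balaban1983to89.FlowStep
open Literature.MathematicalPhysics.QuantumFieldTheory.Balaban1983to89.T4CouplingMatching
  (ScaleShiftRate RemainderShiftRate HistLipschitz EventualLowerH disc injectedRate_of_runs_eventual
    scaleShiftRate_of_split)
open Literature.MathematicalPhysics.QuantumFieldTheory.Balaban1983to89.T4OutputRate (Carriers Functional Window NE5 NE9)
open Literature.MathematicalPhysics.QuantumFieldTheory.Balaban1983to89.T4FlagMemory
  (extd extd_coe extd_adm tail_mem_box Adm fadingMemory_mono)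
open scoped BigOperators

/-! ## §1 The read-out (R) — hypothesis shapes over node U3's carriers -/

section Shapes

variable {C : Carriers}

/-- A TERM FAMILY AT FIXED COUPLINGS: background and localization domain ↦ `E^{(j)}(X; g, U)` with g frozen (a slice of a
`T4OutputRate.Functional`). [cite: Balaban1987RG1, (0.24) p.257] -/
abbrev Slice (C : Carriers) (Bg : Type) : Type := Bg → C.Dom → ℝ

/-- ONE READ-OUT RECIPE PER STEP: `r k F` = the number the recipe (1.20)–(1.22) produces from the scale-(k+1) terms of the
family `F` (node U2's `β k` = β_{k+1}).  Abstract: nothing of (1.20)–(1.22) is modelled. [cite: Balaban1987RG1, (1.20)-(1.22) p.264] -/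
abbrev ReadOut (C : Carriers) (Bg : Type) : Type := ℕ → Slice C Bg → ℝ

/-- Weighted sup-closeness of two term families ON THE SCALE-(k+1) SLICE: `|F U X − G U X| ≤ M·e^{−κd(X)}` for every
background and every domain created at step k + 1 (the printed weight of (1.18) p. 263). [cite: Balaban1987RG1, (1.18) p.263] -/
def SliceClose (κ : ℝ) (k : ℕ) {Bg : Type} (F G : Slice C Bg) (M : ℝ) : Prop :=
  ∀ (U : Bg) (X : C.Dom), C.scale X = k + 1 → |F U X - G U X| ≤ M * Real.exp (-(κ * C.d X))

/-- READ-OUT, RUN A (STRUCTURE PRINTED, (1.20)–(1.22) p. 264: *"the β-functions β_{j+1}(g_j). They are determined by the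
functions E^{(j+1)}(g_j, U_{j+1})"*): on the box `]0, γ]^{k+1}` node U2's history β-function `β k v` is the step-k recipe
applied to the term family `E` at the couplings `extd v` (`T4FlagMemory.extd`: the history padded by its last entry; only
the couplings `v₀, …, v_k` matter on the scale-(k+1) slice under NE9, `T4OutputRate.prefixDependenceOn_of_ne9`).  WHICH
`E`: the instancer's — by p. 264 the infinite-volume family at the probe backgrounds (header §1). [cite: Balaban1987RG1, (1.20)-(1.22) p.264] -/
def RepresentsA {Bg : Type} (E : Functional C Bg) (r : ReadOut C Bg) (γ : ℝ) (β : HBeta) : Prop :=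
  ∀ k (v : Fin (k + 1) → ℝ), v ∈ Box γ k → β k v = r k (E (extd v))

/-- READ-OUT, RUN B (STRUCTURE PRINTED as for run A; the RE-INDEXING is node U3's UNPRINTED convention, GAPS G-t4-U3-5):
run B's β-function one step later, `β (k+1) w` = β_{k+2}(w₀, …, w_{k+1}), is the step-k recipe applied to run B's
RE-INDEXED term family `EB (w 0)` — the unpaired first coupling `w 0 = g^B_0` an explicit PARAMETER — at the re-indexed
couplings `extd (Fin.tail w)` (run A's numbering: slice k + 1). [cite: Balaban1987RG1, (1.20)-(1.22) p.264] -/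
def RepresentsB (EB : ℝ → Functional C C.BgB) (rB : ReadOut C C.BgB) (γ : ℝ) (β : HBeta) : Prop :=
  ∀ k (w : Fin (k + 2) → ℝ), w ∈ Box γ (k + 1) → β (k + 1) w = rB k (EB (w 0) (extd (Fin.tail w)))

/-- PRINTED-INGREDIENT SHAPE (binder; the analogue of `T4OutputRate.LipBackground` for the read-out): the step-k recipe is
`cr`-DOMINATED by the weighted sup-closeness on the scale-(k+1) slice.  What the LINEARITY of (1.20)–(1.22) + a Cauchy
estimate in B on `U^c(X, α₀, α₁)` (p. 263, absolute α₀, α₁) + the locality sums would give; the Cauchy step is NOT carried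
out here and `cr` is NOT PRINTED (cell convention (C5), GAPS C-ne4p1-7). [cite: Balaban1987RG1, §1 p.263 and (1.20)-(1.22) p.264] -/
def ReadBounded {Bg : Type} (r : ReadOut C Bg) (κ cr : ℝ) : Prop :=
  ∀ k (F G : Slice C Bg) (M : ℝ), SliceClose κ k F G M → |r k F - r k G| ≤ cr * M

/-- PAIRING CONVENTION (UNPRINTED, the status of `Carriers.transport`; GAPS G-t4-U1a-2 / G-t4-U3-5): run A's recipe of a
family SEEN THROUGH the background transport and run B's recipe of a family transport-close to it on the scale-(k+1)
slice give `cr·M`-close numbers (same recipe on the two unit lattices; the transport maps run B's probe configurations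
`U_{j+1}(exp iB)` to run A's). [cite: Balaban1987RG1, (1.20)-(1.22) p.264] -/
def ReadCovariant (rA : ReadOut C C.BgA) (rB : ReadOut C C.BgB) (κ cr : ℝ) : Prop :=
  ∀ k (F : Slice C C.BgA) (G : Slice C C.BgB) (M : ℝ),
    (∀ (U : C.BgB) (X : C.Dom), C.scale X = k + 1 →
        |F (C.transport U) X - G U X| ≤ M * Real.exp (-(κ * C.d X))) →
      |rA k F - rB k G| ≤ cr * M

/-- A box history padded by its last entry lies in node U3's window `]0, γ]^ℕ` (`T4FlagMemory.extd_adm`; `T4FlagMemory.Adm γ g`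
and `g ∈ T4OutputRate.Window γ` are the same proposition). [folklore] -/
theorem extd_mem_window {γ : ℝ} {k : ℕ} {v : Fin (k + 1) → ℝ} (hv : v ∈ Box γ k) : extd v ∈ Window γ :=
  extd_adm hv

/-- `Adm γ g ↔ g ∈ Window γ` (both read `∀ m, 0 < g m ∧ g m ≤ γ`). [folklore] -/
theorem adm_iff_mem_window {γ : ℝ} {g : ℕ → ℝ} : Adm γ g ↔ g ∈ Window γ := Iff.rfl

end Shapes

/-! ## §2 The liaison: node U2's NE4 shapes from node U3's shapes and the read-out -/

section Liaison

variable {C : Carriers}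

/-- **η-RATE OF β FROM NE5 (kernel).**  NE5 for EVERY value `b ∈ ]0, γ]` of run B's unpaired first coupling, the two
read-outs and their transport-covariance give node U2's `ScaleShiftRate (cr·C₅·θ) θ γ β`: for `w ∈ ]0, γ]^{k+2}`,
`β_{k+2}(w) − β_{k+1}(tail w) = rB k (EB (w 0) g) − rA k (EA g)` at the SAME re-indexed couplings `g = extd (tail w)`, and NE5
at scale k + 1 makes the two families `C₅θ^{k+1}`-close through the transport.  `W` is any window containing the padded
boxes (`extd_mem_window` for `Window γ`).  Bookkeeping over UNPRINTED inputs. [folklore] -/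
theorem scaleShiftRate_of_ne5 {W : Set (ℕ → ℝ)} {EA : Functional C C.BgA} {EB : ℝ → Functional C C.BgB}
    {rA : ReadOut C C.BgA} {rB : ReadOut C C.BgB} {β : HBeta} {γ κ θ C₅ cr : ℝ}
    (hW : ∀ k (v : Fin (k + 1) → ℝ), v ∈ Box γ k → extd v ∈ W)
    (h5 : ∀ b, 0 < b → b ≤ γ → NE5 EA (EB b) W κ θ C₅)
    (hA : RepresentsA EA rA γ β) (hB : RepresentsB EB rB γ β) (hcov : ReadCovariant rA rB κ cr) :
    ScaleShiftRate (cr * C₅ * θ) θ γ β := by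
  intro k w hw
  have hv : Fin.tail w ∈ Box γ k := tail_mem_box hw
  have hb : 0 < w 0 ∧ w 0 ≤ γ := (mem_box.mp hw) 0
  have hg : extd (Fin.tail w) ∈ W := hW k _ hv
  have h5' := h5 (w 0) hb.1 hb.2 (extd (Fin.tail w)) hg
  have hprem : ∀ (U : C.BgB) (X : C.Dom), C.scale X = k + 1 →
      |EA (extd (Fin.tail w)) (C.transport U) X - EB (w 0) (extd (Fin.tail w)) U X|
        ≤ C₅ * θ ^ (k + 1) * Real.exp (-(κ * C.d X)) := by
    intro U X hX
    have h := h5' U X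
    rw [hX] at h
    exact h
  have hr := hcov k _ _ (C₅ * θ ^ (k + 1)) hprem
  calc |β (k + 1) w - β k (Fin.tail w)|
      = |rA k (EA (extd (Fin.tail w))) - rB k (EB (w 0) (extd (Fin.tail w)))| := by
        rw [hA k _ hv, hB k w hw, abs_sub_comm]
    _ ≤ cr * (C₅ * θ ^ (k + 1)) := hr
    _ = cr * C₅ * θ * θ ^ k := by ring

/-- **HISTORY MODULI OF β FROM NE9 (kernel).**  NE9 for the term family with history moduli `Λ` and the `cr`-dominated
read-out give node U2's `HistLipschitz (fun k i ↦ cr·Λ (k+1) i) γ β` (β_{k+1} reads the scale-(k+1) slice, whose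
dependence on `g_i`, `i ≤ k`, has modulus `Λ (k+1) i`).  Bookkeeping over UNPRINTED inputs. [folklore] -/
theorem histLipschitz_of_ne9 {Bg : Type} {W : Set (ℕ → ℝ)} {E : Functional C Bg} {r : ReadOut C Bg} {β : HBeta}
    {γ κ cr : ℝ} {Λ : ℕ → ℕ → ℝ}
    (hW : ∀ k (v : Fin (k + 1) → ℝ), v ∈ Box γ k → extd v ∈ W)
    (h9 : NE9 E W κ Λ) (hA : RepresentsA E r γ β) (hr : ReadBounded r κ cr) :
    HistLipschitz (fun k i => cr * Λ (k + 1) i) γ β := by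
  intro k p q hp hq
  set S : ℝ := ∑ i : Fin (k + 1), Λ (k + 1) i * |p i - q i| with hS
  have hclose : SliceClose κ k (E (extd p)) (E (extd q)) S := by
    intro U X hX
    have h := h9 (extd p) (hW k p hp) (extd q) (hW k q hq) U X
    rw [hX] at h
    have hsum : ∑ i ∈ Finset.range (k + 1), Λ (k + 1) i * |extd p i - extd q i| = S := by
      rw [hS, ← Fin.sum_univ_eq_sum_range (fun i => Λ (k + 1) i * |extd p i - extd q i|) (k + 1)]
      simp only [extd_coe]
    rw [hsum, mul_comm] at h
    exact h
  have hread := hr k _ _ S hclose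
  calc |β k p - β k q| = |r k (E (extd p)) - r k (E (extd q))| := by rw [hA k p hp, hA k q hq]
    _ ≤ cr * S := hread
    _ = ∑ i : Fin (k + 1), cr * Λ (k + 1) i * |p i - q i| := by
        rw [hS, Finset.mul_sum]
        refine Finset.sum_congr rfl fun i _ => ?_
        ring

/-- **FADING MEMORY TRANSFERS (kernel).**  Node U3's `FadingMemory C₉ ω Λ` (`0 ≤ Λ k i ≤ C₉ω^{k−i}`, i ≤ k) gives node U2's
`FadingMemory (cr·C₉·ω) ω` for the read-out moduli `cr·Λ (k+1) i` (the index shift costs one factor ω).  [folklore] -/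
theorem fadingMemory_readOut {C₉ ω cr : ℝ} {Λ : ℕ → ℕ → ℝ} (hΛ : T4OutputRate.FadingMemory C₉ ω Λ)
    (hcr : 0 ≤ cr) :
    T4CouplingMatching.FadingMemory (cr * C₉ * ω) ω (fun k i => cr * Λ (k + 1) i) := by
  intro k i hik
  obtain ⟨h0, h1⟩ := hΛ (k + 1) i (by omega)
  refine ⟨mul_nonneg hcr h0, ?_⟩
  have hpow : ω ^ (k + 1 - i) = ω * ω ^ (k - i) := by
    rw [show k + 1 - i = (k - i) + 1 by omega, pow_succ, mul_comm]
  calc cr * Λ (k + 1) i ≤ cr * (C₉ * ω ^ (k + 1 - i)) := mul_le_mul_of_nonneg_left h1 hcr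
    _ = cr * C₉ * ω * ω ^ (k - i) := by rw [hpow]; ring

/-- The constant of node U3's `FadingMemory` is nonnegative (`0 ≤ Λ 0 0 ≤ C₉`). [folklore] -/
theorem fadingMemory_const_nonneg {C₉ ω : ℝ} {Λ : ℕ → ℕ → ℝ} (hΛ : T4OutputRate.FadingMemory C₉ ω Λ) : 0 ≤ C₉ := by
  have h := hΛ 0 0 le_rfl
  have := h.1.trans h.2
  simpa using this

/-- `ScaleShiftRate` is monotone in the rate (for a nonnegative constant). [folklore] -/
theorem scaleShiftRate_mono {c θ ρ γ : ℝ} {β : HBeta} (hc : 0 ≤ c) (hθ : 0 ≤ θ) (hθρ : θ ≤ ρ)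
    (h : ScaleShiftRate c θ γ β) : ScaleShiftRate c ρ γ β := fun k w hw =>
  (h k w hw).trans (mul_le_mul_of_nonneg_left (pow_le_pow_left₀ hθ hθρ k) hc)

/-- **NODE U2'S TRIPLE FROM NODE U3 (kernel).**  NE5 (every datum), NE9, node U3's fading memory and the read-out (R) give
`ScaleShiftRate (cr·C₅·θ) θ γ β ∧ HistLipschitz (cr·Λ(·+1)) γ β ∧ FadingMemory (cr·C₉·ω) ω (cr·Λ(·+1))` — NE4 with its
η-rate θ and its memory rate ω kept apart.  Bookkeeping over UNPRINTED inputs. [folklore] -/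
theorem ne4_of_u3 {W : Set (ℕ → ℝ)} {EA : Functional C C.BgA} {EB : ℝ → Functional C C.BgB}
    {rA : ReadOut C C.BgA} {rB : ReadOut C C.BgB} {β : HBeta} {γ κ θ C₅ C₉ ω cr : ℝ} {Λ : ℕ → ℕ → ℝ}
    (hW : ∀ k (v : Fin (k + 1) → ℝ), v ∈ Box γ k → extd v ∈ W)
    (h5 : ∀ b, 0 < b → b ≤ γ → NE5 EA (EB b) W κ θ C₅) (h9 : NE9 EA W κ Λ)
    (hΛ : T4OutputRate.FadingMemory C₉ ω Λ)
    (hA : RepresentsA EA rA γ β) (hB : RepresentsB EB rB γ β) (hr : ReadBounded rA κ cr)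
    (hcov : ReadCovariant rA rB κ cr) (hcr : 0 ≤ cr) :
    ScaleShiftRate (cr * C₅ * θ) θ γ β ∧ HistLipschitz (fun k i => cr * Λ (k + 1) i) γ β ∧
      T4CouplingMatching.FadingMemory (cr * C₉ * ω) ω (fun k i => cr * Λ (k + 1) i) :=
  ⟨scaleShiftRate_of_ne5 hW h5 hA hB hcov, histLipschitz_of_ne9 hW h9 hA hr, fadingMemory_readOut hΛ hcr⟩

/-- The same triple at ONE rate `ρ ≥ max θ ω` (the currency of `T4CouplingMatching.injectedRate_of_runs_eventual`).
[folklore] -/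
theorem ne4_of_u3_oneRate {W : Set (ℕ → ℝ)} {EA : Functional C C.BgA} {EB : ℝ → Functional C C.BgB}
    {rA : ReadOut C C.BgA} {rB : ReadOut C C.BgB} {β : HBeta} {γ κ θ C₅ C₉ ω cr ρ : ℝ} {Λ : ℕ → ℕ → ℝ}
    (hW : ∀ k (v : Fin (k + 1) → ℝ), v ∈ Box γ k → extd v ∈ W)
    (h5 : ∀ b, 0 < b → b ≤ γ → NE5 EA (EB b) W κ θ C₅) (h9 : NE9 EA W κ Λ)
    (hΛ : T4OutputRate.FadingMemory C₉ ω Λ)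
    (hA : RepresentsA EA rA γ β) (hB : RepresentsB EB rB γ β) (hr : ReadBounded rA κ cr)
    (hcov : ReadCovariant rA rB κ cr) (hcr : 0 ≤ cr) (hC₅ : 0 ≤ C₅) (hθ : 0 ≤ θ) (hω : 0 ≤ ω)
    (hθρ : θ ≤ ρ) (hωρ : ω ≤ ρ) :
    ScaleShiftRate (cr * C₅ * θ) ρ γ β ∧ HistLipschitz (fun k i => cr * Λ (k + 1) i) γ β ∧
      T4CouplingMatching.FadingMemory (cr * C₉ * ω) ρ (fun k i => cr * Λ (k + 1) i) := by
  obtain ⟨hS, hL, hM⟩ := ne4_of_u3 hW h5 h9 hΛ hA hB hr hcov hcr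
  have hC₉ : 0 ≤ C₉ := fadingMemory_const_nonneg hΛ
  exact ⟨scaleShiftRate_mono (mul_nonneg (mul_nonneg hcr hC₅) hθ) hθ hθρ hS, hL,
    fadingMemory_mono (mul_nonneg (mul_nonneg hcr hC₉) hω) hω hωρ hM⟩

/-- **NODE U2'S OUTPUT IN THE SPINE'S SHAPE FROM NODE U3 + (R) (kernel).**  `ne4_of_u3_oneRate` composed with pv16's
`T4CouplingMatching.injectedRate_of_runs_eventual`: for a family of runs (history RG equations at every cutoff, the printed
box, the infrared pin), the EVENTUAL asymptotic-freedom lower bound `EventualLowerH b γ k₀ β` (β sub-cell / H3, NOT PRINTED —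
[Balaban1989LargeFieldII] p. 355: the β-function paper "has not been published yet") and the smallness
`cr·C₉·ω·((k₀+1)γ³ + 2γ/b) ≤ (1 − ρ)/2` (a γ-window of printed TYPE, Thm 3 p. 264), the conclusion is
`T4CauchySum.InjectedRate (2·(cr·C₅·θ)/(1−ρ)) 0 ρ (fun K j ↦ disc (g K) (g (K+1)) j)` — verbatim the binder `hinj` of
`T4TowerRateDischarge.uRateUpTo_of_nodes` with `Cd = 2·cr·C₅·θ/(1−ρ)`, `θc = ρ`.  Every hypothesis UNPRINTED or conditional;
nothing of [Balaban1987RG1] is asserted. [cite: Balaban1987RG1, (0.20) p.256 and Thm 3 p.264] -/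
theorem injectedRate_of_u3 {W : Set (ℕ → ℝ)} {EA : Functional C C.BgA} {EB : ℝ → Functional C C.BgB}
    {rA : ReadOut C C.BgA} {rB : ReadOut C C.BgB} {β : HBeta} {γ κ θ C₅ C₉ ω cr ρ b : ℝ} {k₀ : ℕ}
    {Λ : ℕ → ℕ → ℝ} (g : ℕ → ℕ → ℝ) (gIR : ℝ)
    (hW : ∀ k (v : Fin (k + 1) → ℝ), v ∈ Box γ k → extd v ∈ W)
    (h5 : ∀ b, 0 < b → b ≤ γ → NE5 EA (EB b) W κ θ C₅) (h9 : NE9 EA W κ Λ)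
    (hΛ : T4OutputRate.FadingMemory C₉ ω Λ)
    (hA : RepresentsA EA rA γ β) (hB : RepresentsB EB rB γ β) (hr : ReadBounded rA κ cr)
    (hcov : ReadCovariant rA rB κ cr) (hcr : 0 ≤ cr) (hC₅ : 0 ≤ C₅) (hθ : 0 ≤ θ) (hω : 0 ≤ ω)
    (hθρ : θ ≤ ρ) (hωρ : ω ≤ ρ) (hρ0 : 0 < ρ) (hρ1 : ρ < 1) (hγ : 0 < γ) (hb : 0 < b)
    (hrun : ∀ K, RGEqH K β (g K)) (hbox : ∀ K i, i ≤ K → 0 < g K i ∧ g K i ≤ γ) (hpin : ∀ K, g K K = gIR)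
    (hlo : EventualLowerH b γ k₀ β)
    (hsmall : cr * C₉ * ω * (((k₀ : ℝ) + 1) * γ ^ 3 + 2 * γ / b) ≤ (1 - ρ) / 2) :
    T4CauchySum.InjectedRate (2 * (cr * C₅ * θ) / (1 - ρ)) 0 ρ (fun K j => disc (g K) (g (K + 1)) j) := by
  obtain ⟨hS, hL, hM⟩ := ne4_of_u3_oneRate hW h5 h9 hΛ hA hB hr hcov hcr hC₅ hθ hω hθρ hωρ
  have hC₉ : 0 ≤ C₉ := fadingMemory_const_nonneg hΛ
  exact injectedRate_of_runs_eventual g gIR hγ hb hρ0 hρ1 (mul_nonneg (mul_nonneg hcr hC₅) hθ)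
    (mul_nonneg (mul_nonneg hcr hC₉) hω) hrun hbox hpin hS hL hM hlo hsmall

/-- **THE SPLIT BOOKING, β¹-HALF (kernel).**  The cell books NE4 as β⁰-half (the one-loop numbers, (AF-0r) of the β sub-cell)
+ β¹-half `RemainderShiftRate` (T4-DAG §6).  If the REMAINDER `S.β1` of a `B12Beta.OneLoopSplit` is read off remainder term
families `E¹A`, `E¹B b` (the instancer's: E minus its one-loop terms) obeying NE5 for every datum, then
`RemainderShiftRate S (cr·C₅·θ) θ γ` — `scaleShiftRate_of_ne5` for the history family `S.β1`
(`T4FlagMemory.remainderShiftRate_iff`). [folklore] -/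
theorem remainderShiftRate_of_ne5 {β : HBeta} (S : B12Beta.OneLoopSplit β) {W : Set (ℕ → ℝ)}
    {EA : Functional C C.BgA} {EB : ℝ → Functional C C.BgB} {rA : ReadOut C C.BgA} {rB : ReadOut C C.BgB}
    {γ κ θ C₅ cr : ℝ}
    (hW : ∀ k (v : Fin (k + 1) → ℝ), v ∈ Box γ k → extd v ∈ W)
    (h5 : ∀ b, 0 < b → b ≤ γ → NE5 EA (EB b) W κ θ C₅)
    (hA : RepresentsA EA rA γ S.β1) (hB : RepresentsB EB rB γ S.β1) (hcov : ReadCovariant rA rB κ cr) :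
    RemainderShiftRate S (cr * C₅ * θ) θ γ :=
  scaleShiftRate_of_ne5 hW h5 hA hB hcov

/-- **THE SPLIT BOOKING, FULL β (kernel).**  `remainderShiftRate_of_ne5` ∘ pv16's `scaleShiftRate_of_split`: with (AF-0r)
`|β⁰_{k+1} − β_∞| ≤ c₀θ^k` (β sub-cell, BetaPertH member — a HYPOTHESIS here) the full β has
`ScaleShiftRate (2c₀ + cr·C₅·θ) θ γ β`. [folklore] -/
theorem scaleShiftRate_of_ne5_split {β : HBeta} (S : B12Beta.OneLoopSplit β) {W : Set (ℕ → ℝ)}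
    {EA : Functional C C.BgA} {EB : ℝ → Functional C C.BgB} {rA : ReadOut C C.BgA} {rB : ReadOut C C.BgB}
    {γ κ θ C₅ cr binf c₀ : ℝ}
    (hW : ∀ k (v : Fin (k + 1) → ℝ), v ∈ Box γ k → extd v ∈ W)
    (h5 : ∀ b, 0 < b → b ≤ γ → NE5 EA (EB b) W κ θ C₅)
    (hA : RepresentsA EA rA γ S.β1) (hB : RepresentsB EB rB γ S.β1) (hcov : ReadCovariant rA rB κ cr)
    (hθ0 : 0 ≤ θ) (hθ1 : θ ≤ 1) (hc₀ : 0 ≤ c₀) (hconv : ∀ k, |S.β0 k - binf| ≤ c₀ * θ ^ k) :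
    ScaleShiftRate (2 * c₀ + cr * C₅ * θ) θ γ β :=
  scaleShiftRate_of_split S hθ0 hθ1 hc₀ hconv (remainderShiftRate_of_ne5 S hW h5 hA hB hcov)

end Liaison

/-! ## §3 The converse on the β-carrier: node U2's shapes are an instance of node U3's -/

section BetaCarrier

/-- THE β-CARRIER: domains = step indices `n : ℕ` with creation scale `n + 1` and zero tree length, one-point backgrounds
for both runs, identity transport.  On it a `Functional` is just a history-dependent family of numbers — e.g. the
β-functions themselves.  (`@[reducible]`: the projections `betaCarriers.Dom = ℕ` etc. must unfold during instance
synthesis.) [folklore] -/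
@[reducible] def betaCarriers : Carriers where
  Dom := ℕ
  scale := fun n => n + 1
  d := fun _ => 0
  d_nonneg := fun _ => le_rfl
  BgA := PUnit
  BgB := PUnit
  gauge := fun _ _ => 0
  gauge_nonneg := fun _ _ => le_rfl
  transport := fun u => u

/-- Run A's functional on the β-carrier: at couplings `g` and domain `n`, the number `β n (g₀, …, g_n)` = β_{n+1}. [folklore] -/
def betaEA (β : HBeta) : Functional betaCarriers PUnit :=
  fun (g : ℕ → ℝ) (_ : PUnit) (n : ℕ) => β n (fun i : Fin (n + 1) => g i)

/-- Run B's RE-INDEXED functional on the β-carrier with the unpaired datum `b` consed in front: at re-indexed couplings `g`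
and domain `n`, the number `β (n+1) (b, g₀, …, g_n)` = β_{n+2}(b, g₀, …, g_n). [folklore] -/
def betaEB (β : HBeta) (b : ℝ) : Functional betaCarriers PUnit :=
  fun (g : ℕ → ℝ) (_ : PUnit) (n : ℕ) => β (n + 1) (Fin.cons b (fun i : Fin (n + 1) => g i))

/-- The read-out on the β-carrier: evaluation at the one background and the domain `k`. [folklore] -/
def betaRead : ReadOut betaCarriers PUnit := fun (k : ℕ) (F : Slice betaCarriers PUnit) => F PUnit.unit k

/-- History moduli transported to node U3's indexing (scale `n` ↔ node U2's index `n − 1`), zero off the triangle. [folklore] -/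
def shiftModuli (Λ : ℕ → ℕ → ℝ) : ℕ → ℕ → ℝ := fun n i => if i < n then Λ (n - 1) i else 0

/-- On the β-carrier the β-family is read off run A's functional `betaEA β` by evaluation (`extd_coe`). [folklore] -/
theorem representsA_beta (β : HBeta) (γ : ℝ) : RepresentsA (betaEA β) betaRead γ β := by
  intro k v _
  show β k v = β k (fun i : Fin (k + 1) => extd v i)
  congr 1
  funext i
  exact (extd_coe v i).symm

/-- On the β-carrier the β-family one step later is read off run B's re-indexed functional `betaEB β (w 0)` by evaluation
(`Fin.cons (w 0) (Fin.tail w) = w`). [folklore] -/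
theorem representsB_beta (β : HBeta) (γ : ℝ) : RepresentsB (betaEB β) betaRead γ β := by
  intro k w _
  show β (k + 1) w = β (k + 1) (Fin.cons (w 0) (fun i : Fin (k + 1) => extd (Fin.tail w) i))
  congr 1
  funext i
  refine Fin.cases ?_ (fun j => ?_) i
  · simp
  · simp [Fin.tail]

/-- Evaluation is 1-dominated by the slice closeness (weight κ = 0, tree length 0). [folklore] -/
theorem readBounded_beta : ReadBounded betaRead 0 1 := by
  intro k F G M h
  have h' := h PUnit.unit k rfl
  simpa [betaRead, betaCarriers] using h'

/-- Evaluation is transport-covariant with constant 1 (identity transport on the one-point backgrounds). [folklore] -/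
theorem readCovariant_beta : ReadCovariant betaRead betaRead 0 1 := by
  intro k F G M h
  have h' := h PUnit.unit k rfl
  simpa [betaRead, betaCarriers] using h'

/-- A window sequence restricted to its first `n + 1` entries lies in the box. [folklore] -/
theorem prefix_mem_box {γ : ℝ} {g : ℕ → ℝ} (hg : g ∈ Window γ) (n : ℕ) :
    (fun i : Fin (n + 1) => g i) ∈ Box γ n :=
  mem_box.mpr fun i => hg i

/-- **U2 ⇒ U3 on the β-carrier, history moduli (kernel).**  `HistLipschitz Λ γ β` is NE9 for `betaEA β` on the window with
moduli `shiftModuli Λ` and weight κ = 0. [folklore] -/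
theorem ne9_beta_of_histLipschitz {Λ : ℕ → ℕ → ℝ} {γ : ℝ} {β : HBeta} (h : HistLipschitz Λ γ β) :
    NE9 (betaEA β) (Window γ) 0 (shiftModuli Λ) := by
  intro g hg g' hg' U n
  have hh := h n _ _ (prefix_mem_box hg n) (prefix_mem_box hg' n)
  have hsum : ∑ i : Fin (n + 1), Λ n i * |g i - g' i|
      = ∑ i ∈ Finset.range (n + 1), shiftModuli Λ (n + 1) i * |g i - g' i| := by
    rw [← Fin.sum_univ_eq_sum_range (fun i => shiftModuli Λ (n + 1) i * |g i - g' i|) (n + 1)]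
    refine Finset.sum_congr rfl fun i _ => ?_
    simp [shiftModuli, i.isLt]
  show |β n (fun i : Fin (n + 1) => g i) - β n (fun i : Fin (n + 1) => g' i)|
    ≤ Real.exp (-(0 * (0 : ℝ))) * ∑ i ∈ Finset.range (n + 1), shiftModuli Λ (n + 1) i * |g i - g' i|
  rw [← hsum]
  simpa using hh

/-- **U2 ⇒ U3 on the β-carrier, fading memory (kernel).**  Node U2's `FadingMemory C θ Λ` is node U3's
`FadingMemory (C/θ) θ (shiftModuli Λ)` (θ > 0). [folklore] -/
theorem fadingMemory_beta {C θ : ℝ} {Λ : ℕ → ℕ → ℝ} (hθ0 : 0 < θ)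
    (h : T4CouplingMatching.FadingMemory C θ Λ) : T4OutputRate.FadingMemory (C / θ) θ (shiftModuli Λ) := by
  have hC : 0 ≤ C := by
    have h00 := h 0 0 le_rfl
    have := h00.1.trans h00.2
    simpa using this
  intro n i hin
  by_cases hi : i < n
  · obtain ⟨h0, h1⟩ := h (n - 1) i (by omega)
    have hpow : C * θ ^ (n - 1 - i) = C / θ * θ ^ (n - i) := by
      rw [show n - i = (n - 1 - i) + 1 by omega, pow_succ]
      field_simp
    refine ⟨by simp [shiftModuli, hi, h0], ?_⟩
    simp only [shiftModuli, hi, if_true]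
    rw [← hpow]
    exact h1
  · refine ⟨by simp [shiftModuli, hi], ?_⟩
    simp only [shiftModuli, hi, if_false]
    exact mul_nonneg (div_nonneg hC hθ0.le) (pow_nonneg hθ0.le _)

/-- **U2 ⇒ U3 on the β-carrier, η-rate (kernel).**  `ScaleShiftRate c θ γ β` (θ > 0) is NE5 for the pair
(`betaEA β`, `betaEB β b`) for every datum `b ∈ ]0, γ]`, with constant `c/θ` (creation scale n + 1 ↔ node U2's index n). [folklore] -/
theorem ne5_beta_of_scaleShiftRate {c θ γ : ℝ} {β : HBeta} (hθ : 0 < θ) (h : ScaleShiftRate c θ γ β)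
    {b : ℝ} (hb0 : 0 < b) (hbγ : b ≤ γ) :
    NE5 (betaEA β) (betaEB β b) (Window γ) 0 θ (c / θ) := by
  intro g hg U n
  have hw : (Fin.cons b (fun i : Fin (n + 1) => g i) : Fin (n + 2) → ℝ) ∈ Box γ (n + 1) := by
    refine mem_box.mpr fun i => ?_
    refine Fin.cases ?_ (fun j => ?_) i
    · simpa using And.intro hb0 hbγ
    · simpa using hg j
  have hh := h n _ hw
  rw [Fin.tail_cons, abs_sub_comm] at hh
  have hθn : c / θ * θ ^ (n + 1) = c * θ ^ n := by
    rw [pow_succ]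
    field_simp
  show |β n (fun i : Fin (n + 1) => g i) - β (n + 1) (Fin.cons b fun i : Fin (n + 1) => g i)|
    ≤ c / θ * θ ^ (n + 1) * Real.exp (-(0 * (0 : ℝ)))
  rw [hθn]
  simpa using hh

/-- **ROUND TRIP, η-rate (kernel).**  U2 ⇒ U3 (`ne5_beta_of_scaleShiftRate`) ⇒ U2 (`scaleShiftRate_of_ne5`) returns
`ScaleShiftRate` with the SAME constant: `1 · (c/θ) · θ = c`. [folklore] -/
theorem scaleShiftRate_roundTrip {c θ γ : ℝ} {β : HBeta} (hθ : 0 < θ) (h : ScaleShiftRate c θ γ β) :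
    ScaleShiftRate (1 * (c / θ) * θ) θ γ β :=
  scaleShiftRate_of_ne5 (W := Window γ) (fun _ _ hv => extd_mem_window hv)
    (fun _ hb0 hbγ => ne5_beta_of_scaleShiftRate hθ h hb0 hbγ) (representsA_beta β γ) (representsB_beta β γ)
    readCovariant_beta

/-- The round-trip constant is the original one. [folklore] -/
theorem roundTrip_const {c θ : ℝ} (hθ : 0 < θ) : 1 * (c / θ) * θ = c := by
  field_simp

/-- **ROUND TRIP, history moduli (kernel).**  U2 ⇒ U3 (`ne9_beta_of_histLipschitz`) ⇒ U2 (`histLipschitz_of_ne9`) returns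
`HistLipschitz` with the moduli `1 · shiftModuli Λ (k+1) i`, which EQUAL `Λ k i` on the triangle `i ≤ k`
(`shiftModuli_succ`). [folklore] -/
theorem histLipschitz_roundTrip {Λ : ℕ → ℕ → ℝ} {γ : ℝ} {β : HBeta} (h : HistLipschitz Λ γ β) :
    HistLipschitz (fun k i => 1 * shiftModuli Λ (k + 1) i) γ β :=
  histLipschitz_of_ne9 (W := Window γ) (fun _ _ hv => extd_mem_window hv) (ne9_beta_of_histLipschitz h)
    (representsA_beta β γ) readBounded_beta

/-- On the triangle the transported moduli are the original ones. [folklore] -/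
theorem shiftModuli_succ (Λ : ℕ → ℕ → ℝ) {k i : ℕ} (hik : i ≤ k) : 1 * shiftModuli Λ (k + 1) i = Λ k i := by
  have : i < k + 1 := Nat.lt_succ_of_le hik
  simp [shiftModuli, this]

/-- **ROUND TRIP, fading memory (kernel).**  U2 ⇒ U3 (`fadingMemory_beta`) ⇒ U2 (`fadingMemory_readOut` with `cr = 1`)
returns node U2's `FadingMemory` with the constant `1 · (C/θ) · θ = C` and the transported moduli. [folklore] -/
theorem fadingMemory_roundTrip {C θ : ℝ} {Λ : ℕ → ℕ → ℝ} (hθ0 : 0 < θ)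
    (h : T4CouplingMatching.FadingMemory C θ Λ) :
    T4CouplingMatching.FadingMemory (1 * (C / θ) * θ) θ (fun k i => 1 * shiftModuli Λ (k + 1) i) :=
  fadingMemory_readOut (fadingMemory_beta hθ0 h) zero_le_one

/-- `HistLipschitz` only ever evaluates the moduli on the triangle `i ≤ k`, where the transported moduli are the original
ones: the two `HistLipschitz` statements are equivalent. [folklore] -/
theorem histLipschitz_shiftModuli_iff {Λ : ℕ → ℕ → ℝ} {γ : ℝ} {β : HBeta} :
    HistLipschitz (fun k i => 1 * shiftModuli Λ (k + 1) i) γ β ↔ HistLipschitz Λ γ β := by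
  have key : ∀ k (p q : Fin (k + 1) → ℝ),
      ∑ i : Fin (k + 1), (fun k i => 1 * shiftModuli Λ (k + 1) i) k i * |p i - q i|
        = ∑ i : Fin (k + 1), Λ k i * |p i - q i| := by
    intro k p q
    refine Finset.sum_congr rfl fun i _ => ?_
    show 1 * shiftModuli Λ (k + 1) i * |p i - q i| = Λ k i * |p i - q i|
    rw [shiftModuli_succ Λ (Nat.le_of_lt_succ i.isLt)]
  constructor
  · intro h k p q hp hq
    rw [← key]
    exact h k p q hp hq
  · intro h k p q hp hq
    rw [key]
    exact h k p q hp hq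

/-- **NE4'S SHAPES ARE AN INSTANCE OF NE5 ∧ NE9 (kernel, the booking statement).**  For every history family `β`, every box
size `γ` and every rate `θ > 0`: node U2's pair (`ScaleShiftRate c θ γ β`, `HistLipschitz Λ γ β`) holds IF AND ONLY IF node
U3's pair (NE5 for `betaEA β` / `betaEB β b` for every datum `b ∈ ]0, γ]` with constant `c/θ`, NE9 for `betaEA β` with moduli
`shiftModuli Λ`) holds on the β-carrier with weight κ = 0 (and `fadingMemory_beta` / `fadingMemory_roundTrip` transport the
fading-memory clause both ways).  A statement about the TYPED SHAPES only; nothing printed is involved. [folklore] -/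
theorem u2Shapes_iff_u3Shapes_on_betaCarrier {c θ γ : ℝ} {Λ : ℕ → ℕ → ℝ} {β : HBeta} (hθ : 0 < θ) :
    (ScaleShiftRate c θ γ β ∧ HistLipschitz Λ γ β) ↔
      ((∀ b, 0 < b → b ≤ γ → NE5 (betaEA β) (betaEB β b) (Window γ) 0 θ (c / θ)) ∧
        NE9 (betaEA β) (Window γ) 0 (shiftModuli Λ)) := by
  constructor
  · rintro ⟨hS, hL⟩
    exact ⟨fun b hb0 hbγ => ne5_beta_of_scaleShiftRate hθ hS hb0 hbγ, ne9_beta_of_histLipschitz hL⟩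
  · rintro ⟨h5, h9⟩
    refine ⟨?_, ?_⟩
    · have h := scaleShiftRate_of_ne5 (W := Window γ) (fun _ _ hv => extd_mem_window hv) h5
        (representsA_beta β γ) (representsB_beta β γ) readCovariant_beta
      rwa [roundTrip_const hθ] at h
    · exact histLipschitz_shiftModuli_iff.mp
        (histLipschitz_of_ne9 (W := Window γ) (fun _ _ hv => extd_mem_window hv) h9 (representsA_beta β γ)
          readBounded_beta)

end BetaCarrier

end Literature.MathematicalPhysics.QuantumFieldTheory.Balaban1983to89.T4BetaReadOut
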